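import Literature.NumberTheory.GaloisRepresentations.ModPGaloisRep
import Literature.NumberTheory.GaloisRepresentations.LocalGaloisGroupProofs
import Literature.NumberTheory.GaloisRepresentations.RamificationFiltrationProofs
import HarnessLib

/-!
# Tame and wild inertia of a non-archimedean local field (trunk GalRep, items C4/C9/C15)

Structure facts about the inertia group `I_F = absInertia F` of a non-archimedean local field
`F` (residue field `𝓀[F]` of characteristic `p` and cardinality `q`), its upper-numbering
filtration `I_F^v = absUpperInertia F v` (item C9) and the Kummer characters
`θ_d = kummerCharacter F …` / fundamental characters `ψ_n = fundamentalCharacter F n …`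
(item C15), as they enter Serre's analysis of `ρ̄|I_F` for a mod `p` representation
(Serre, Duke Math. J. 54 (1987), §2.1, Prop. 1; vendored for the proof of
`ModPGaloisRep.exists_isSerreWeight`, file `SerreWeightProofs`).  In Serre's notation
`I_p ⊆ I` is the wild inertia group (the largest pro-`p` subgroup of `I`) and
`I_t = I / I_p ≃ lim← μ_d ≃ lim← 𝔽_{qⁿ}^*` is the tame inertia group.  Everything is phrased
for continuous homomorphisms `f : Γ_F →ₜ* H` into a *discrete* group `H` (open kernel, finite
image), which is how the facts are consumed.

Named facts (`def X : Prop`, cited; D-0014):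

* `absUpperInertia_map_isPGroup F H` — for `v > 0` the image of `I_F^v` in a discrete group is
  a `p`-group (`I_F^v ⊆ I_p` is pro-`p`: at finite level `G^v ⊆ G_1` for `v > 0` and `G_1` is
  a `p`-group).  Serre, *Local Fields*, Ch. IV §2, Cor. 3 of Prop. 7 and §3 (upper numbering,
  Remark 1); Serre (1972), §1.2.
* `absInertia_map_isCyclic F H` — if `f` kills every `I_F^v`, `v > 0` (i.e. `f` is tame), then
  `f(I_F)` is a finite cyclic group of order prime to `p` (a finite quotient of
  `I_t ≃ lim← 𝔽_{qⁿ}^*`).  Serre (1972), §1.2–§1.3, Prop. 1–2; Serre, *Local Fields*, Ch. IV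
  §2, Cor. 1 of Prop. 7.
* `exists_eq_kummerCharacter_pow F k` — every continuous character `χ : I_F → kˣ` with
  `χ ^ d = 1`, `p ∤ d`, is a power of `θ_d` (pushed into `k` by the residue embedding `ι`):
  `Hom(I_t, μ_d)` is cyclic generated by `θ_d`.  Serre (1972), §1.3 (`θ_d : Gal(K_d/K_nr) ≃ μ_d`,
  `K_t = ⋃ K_d`) and §1.7, Prop. 5.

Theorems (proved here):

* `absUpperInertia_normal F v` — `I_F^v ⊴ Γ_F` (from `absUpperRamificationSubgroup_smul` and
  `smul_absMaximalIdeal_holds`).  Serre, *Local Fields*, Ch. IV §1 Prop. 1, §3 Prop. 14.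
* `kummerCharacter_conj_apply` — **conjugation by a Frobenius power acts on `θ_d` by
  `u ↦ u ^ (q ^ m)`**: `θ_d(τ σ τ⁻¹) = θ_d(σ) ^ (q ^ m)` whenever `IsFrobPow τ m`
  (Serre 1987, §2.1: "`s u s⁻¹ ≡ u^p (mod I_p)`"; Serre 1972, §1.8, Prop. 6).  The proof is the
  cocycle computation `c(τστ⁻¹) · τ(u) = τσ(u) · τ(c(σ))` with `u = c(τ⁻¹)` a root of unity,
  reduced modulo `𝔓` using only `σ ∈ I_F` and the defining congruence of `IsFrobPow`.
* `exists_isPrimitiveRoot_of_not_dvd` — a field `k` receiving a ring homomorphism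
  `ι : S ⧸ 𝔓 →+* k` contains a primitive `e`-th root of unity for every `e > 0` prime to `p`
  (reduction of `μ_e(F̄) ⊆ S` is injective modulo any proper ideal above `𝔓`, because
  `1 + η + ⋯ + η^{m-1} = m` is a unit for `η ≡ 1` a primitive `m`-th root, `p ∤ m`).
  Serre (1972), §1.3 ("`μ_d` s'identifie par réduction … aux racines `d`-ièmes de l'unité de
  `k_s`").
* `charP_of_residueEmbedding` — such a `k` has characteristic `p`.

## Design choices

* The facts quantify over an arbitrary discrete group `H` (a `def` parameter, so that no
  universe is hidden in the `Prop`); they are used with `H = GL (Fin 2) k`.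
* `p` is written `ringChar 𝓀[F]`, `q` is `residueFieldCard F` (item C1).
* "Order prime to `p`" of a finite image is `(Nat.card _).Coprime p`; this also records
  finiteness (`Nat.card = 0` for an infinite group is not coprime to `p`).
* Nothing here depends on the maximality of `𝔓 = absMaximalIdeal F`: the theorems only use
  that `𝔓` is a `Γ_F`-stable ideal containing `p`, that `ker (ι ∘ mk)` is a proper ideal, and
  the elementwise congruences defining `absInertia` and `IsFrobPow`.

## References

* J.-P. Serre, *Propriétés galoisiennes des points d'ordre fini des courbes elliptiques*,
  Invent. Math. 15 (1972), §1.1–§1.8 (Prop. 1, 2, 4, 5, 6). [SerreInventiones1972]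
* J.-P. Serre, *Sur les représentations modulaires de degré 2 de `Gal(ℚ̄/ℚ)`*, Duke Math. J.
  54 (1987), §2.1. [Serre1987]
* J.-P. Serre, *Local Fields*, GTM 67 (1979), Ch. IV §1 Prop. 1, §2 Cor. 1 and Cor. 3 of
  Prop. 7, §3 Prop. 14 and Remark 1. [SerreLocalFields1979]
-/

noncomputable section

open scoped Pointwise Valued
open Field ValuativeRel

namespace Literature.NumberTheory.GaloisRepresentations

open GaloisRepresentations.IsNonarchimedeanLocalField

universe u v w

variable (F : Type u) [Field F] [ValuativeRel F] [TopologicalSpace F] [IsNonarchimedeanLocalField F]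

/-! ### Wild inertia: the groups `I_F^v`, `v > 0` -/

section Wild

variable (H : Type w) [Group H] [TopologicalSpace H]

/-- **The image of `I_F^v` (`v > 0`) in a discrete group is a `p`-group.**  For a continuous
homomorphism `f : Γ_F → H` into a discrete group (open kernel, so `f` factors through a finite
Galois group `G = Gal(E/F)`), `f(I_F^v) ⊆ f̄(G^v)` and `G^v ⊆ G_1` for `v > 0`, where `G_1`,
the wild inertia group of `E/F`, is a `p`-group (`p = char 𝓀[F]`); equivalently `I_F^v`
(`v > 0`) is contained in the wild inertia group `I_p`, the largest pro-`p` subgroup of `I_F`.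
Ref: Serre, *Local Fields*, Ch. IV §2, Cor. 3 of Prop. 7 (`G_1` is a `p`-group) and §3,
Remark 1 after Prop. 14 (upper numbering of `Gal(F̄/F)`); Serre, Invent. Math. 15 (1972), §1.2
(`I_p` "le plus grand pro-`p`-groupe contenu dans `I`").
[cite: SerreLocalFields1979, Ch. IV §2 Cor. 3 of Prop. 7 and §3 Remark 1]
[cite: SerreInventiones1972, §1.2] -/
def absUpperInertia_map_isPGroup : Prop :=
  ∀ [DiscreteTopology H] (f : absoluteGaloisGroup F →ₜ* H) {v : ℝ} (_hv : 0 < v),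
    IsPGroup (ringChar 𝓀[F]) ((absUpperInertia F v).map f.toMonoidHom)

/-- **`I_F^v` is a normal subgroup of `Γ_F`.**  The absolute upper-numbering groups of a
conjugate prime are the conjugate groups (`absUpperRamificationSubgroup_smul`:
`Γ^v(σ𝔓) = σ Γ^v(𝔓) σ⁻¹`), and `σ • 𝔓 = 𝔓` for the canonical prime of a local field
(`smul_absMaximalIdeal_holds`).
Ref: Serre, *Local Fields*, Ch. IV §1, Prop. 1 (`G_i ⊴ G`) and §3, Prop. 14 with Remark 1.
[cite: SerreLocalFields1979, Ch. IV §1 Prop. 1 and §3 Prop. 14, Remark 1] -/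
theorem absUpperInertia_normal (v : ℝ) : (absUpperInertia F v).Normal := by
  refine ⟨fun x hx σ => ?_⟩
  have h := absUpperRamificationSubgroup_smul (R := 𝒪[F]) σ (absMaximalIdeal F) v
  rw [smul_absMaximalIdeal_holds F σ] at h
  have hx' : MulAut.conj σ • x ∈
      MulAut.conj σ • absUpperRamificationSubgroup 𝒪[F] (absMaximalIdeal F) v :=
    Subgroup.smul_mem_pointwise_smul _ _ _ hx
  rw [← h, MulAut.smul_def, MulAut.conj_apply] at hx'
  exact hx'

/-- **Tame quotients of inertia are cyclic of order prime to `p`.**  If a continuous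
homomorphism `f : Γ_F → H` into a discrete group kills every `I_F^v`, `v > 0` (i.e. `f` is
tamely ramified: it kills the wild inertia group `I_p`), then `f(I_F)` is a finite cyclic group
of order prime to `p`: it is a finite quotient of the tame inertia group
`I_t = I_F / I_p ≃ lim← μ_d ≃ lim← 𝔽_{qⁿ}^*` ("groupe profini commutatif, d'ordre premier à
`p`"), equivalently a quotient of `G_0 / G_1` for a finite Galois `E/F`, which is cyclic of
order prime to `p`.
Ref: Serre, Invent. Math. 15 (1972), §1.2 and §1.3, Prop. 1–2; Serre, *Local Fields*, Ch. IV
§2, Cor. 1 of Prop. 7 and §3, Remark 1.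
[cite: SerreInventiones1972, §1.2–1.3 Prop. 1–2]
[cite: SerreLocalFields1979, Ch. IV §2 Cor. 1 of Prop. 7] -/
def absInertia_map_isCyclic : Prop :=
  ∀ [DiscreteTopology H] (f : absoluteGaloisGroup F →ₜ* H)
    (_hf : ∀ v : ℝ, 0 < v → ∀ σ ∈ absUpperInertia F v, f σ = 1),
    IsCyclic ((absInertia F).map f.toMonoidHom) ∧
      (Nat.card ((absInertia F).map f.toMonoidHom)).Coprime (ringChar 𝓀[F])

end Wild

/-! ### Characters of the inertia group -/

section Characters

variable (k : Type v) [Field k]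

/-- **Continuous characters of `I_F` of exponent `d` prime to `p` are powers of `θ_d`.**  Let
`ι : S ⧸ 𝔓 →+* k` be a residue embedding, `ϖ` a uniformiser and
`θ_d = kummerCharacter F hd hϖ.ne_zero ι : I_F → kˣ`, `σ ↦ ι(σ(ϖ^{1/d}) / ϖ^{1/d} mod 𝔓)`.  If
`k` is discrete and `χ : I_F → kˣ` is a continuous character with `χ ^ d = 1`, `p ∤ d`, then
`χ = θ_d ^ a` for some `a`.  (Such a `χ` has finite image of order prime to `p`, hence factors
through the tame inertia group `I_t`; by Serre, `θ_d` identifies `Gal(K_d / K_nr)`,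
`K_d = K_nr(ϖ^{1/d})`, with `μ_d`, `K_t = ⋃_d K_d`, and the character group `Hom(I_t, k_s^*)` is
`(ℚ/ℤ)'` via `a/d ↦ θ_d ^ a` (Prop. 5); characters into any field `k₁` of characteristic `p`
are obtained by composing with an embedding, here `ι`, and `μ_d(k) = ι(μ_d)`.)
Ref: Serre, Invent. Math. 15 (1972), §1.3 (structure of `I_t`, `θ_d`) and §1.7, Prop. 5.
[cite: SerreInventiones1972, §1.3 and §1.7 Prop. 5] -/
def exists_eq_kummerCharacter_pow [TopologicalSpace k] : Prop :=
  ∀ [DiscreteTopology k] (ι : absIntegers 𝒪[F] F ⧸ absMaximalIdeal F →+* k) {d : ℕ} (hd : 0 < d)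
    (_hpd : ¬ ringChar 𝓀[F] ∣ d) {ϖ : 𝒪[F]} (hϖ : Irreducible ϖ) (χ : ↥(absInertia F) →* kˣ)
    (_hχ : Continuous χ) (_hχd : ∀ σ, χ σ ^ d = 1),
    ∃ a : ℕ, χ = kummerCharacter F hd hϖ.ne_zero ι ^ a

variable {F k}

omit [TopologicalSpace F] [IsNonarchimedeanLocalField F] in
/-- The Kummer cocycle of a root of a non-zero element is a unit of `S` (it is a root of
unity: `c(σ) ^ n = 1`).  Ref: Serre, Invent. Math. 15 (1972), §1.3. [folklore] -/
theorem kummerCocycleInt_pow {n : ℕ} (hn : 0 < n) {a : 𝒪[F]} (ha : a ≠ 0)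
    (σ : absoluteGaloisGroup F) : kummerCocycleInt F hn ha σ ^ n = 1 :=
  Subtype.ext (by rw [SubmonoidClass.coe_pow, coe_kummerCocycleInt, kummerCocycle_pow F hn ha,
    OneMemClass.coe_one])

omit [TopologicalSpace F] [IsNonarchimedeanLocalField F] in
/-- The cocycle identity in `S`: `c(σ τ) = σ • c(τ) * c(σ)`.
Ref: Serre, Invent. Math. 15 (1972), §1.3. [folklore] -/
theorem kummerCocycleInt_mul {n : ℕ} (hn : 0 < n) {a : 𝒪[F]} (ha : a ≠ 0)
    (σ τ : absoluteGaloisGroup F) :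
    kummerCocycleInt F hn ha (σ * τ) = σ • kummerCocycleInt F hn ha τ * kummerCocycleInt F hn ha σ :=
  Subtype.ext (by
    rw [coe_kummerCocycleInt, kummerCocycle_mul F hn ha, MulMemClass.coe_mul,
      integralClosure.coe_smul, coe_kummerCocycleInt, coe_kummerCocycleInt])

omit [TopologicalSpace F] [IsNonarchimedeanLocalField F] in
/-- `c(1) = 1` in `S`.  Ref: Serre, Invent. Math. 15 (1972), §1.3. [folklore] -/
theorem kummerCocycleInt_one {n : ℕ} (hn : 0 < n) {a : 𝒪[F]} (ha : a ≠ 0) :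
    kummerCocycleInt F hn ha 1 = 1 :=
  Subtype.ext (by rw [coe_kummerCocycleInt, kummerCocycle_one F hn ha, OneMemClass.coe_one])

/-- **Conjugation by a Frobenius power acts on the Kummer characters by `u ↦ u ^ (q ^ m)`.**
If `τ ∈ Γ_F` acts on `S ⧸ 𝔓` as `x ↦ x ^ (q ^ m)` (`IsFrobPow τ m`, e.g. an arithmetic
Frobenius, `m = 1`) and `σ ∈ I_F`, then `θ(τ σ τ⁻¹) = θ(σ) ^ (q ^ m)` for every Kummer
character `θ = kummerCharacter F hn ha ι` (in particular for the fundamental characters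
`ψ_n`).  This is Serre's "`s u s⁻¹ ≡ u^p (mod I_p)`: la conjugaison par `s` opère sur
`I_t = I/I_p` par `u ↦ u^p`", in the form in which it is used.  Proof: with `c` the Kummer
cocycle and `u = c(τ⁻¹)` (a root of unity in `S`), `c(τστ⁻¹) · τ(u) = τσ(u) · τ(c(σ))`;
modulo `𝔓`, `τσ(u) ≡ τ(u)` (apply the congruence defining `IsFrobPow τ m` to
`σ(u) - u ∈ 𝔓`) and `τ(c(σ)) ≡ c(σ)^{q^m}`, and `τ(u)` is a unit.
Ref: Serre, Duke Math. J. 54 (1987), §2.1; Serre, Invent. Math. 15 (1972), §1.8, Prop. 6.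
[cite: Serre1987, §2.1 (sus⁻¹ ≡ u^p mod I_p)] [cite: SerreInventiones1972, §1.8 Prop. 6] -/
theorem kummerCharacter_conj_apply {n : ℕ} (hn : 0 < n) {a : 𝒪[F]} (ha : a ≠ 0)
    (ι : absIntegers 𝒪[F] F ⧸ absMaximalIdeal F →+* k) {τ : absoluteGaloisGroup F} {m : ℕ}
    (hτ : IsFrobPow τ m) (σ : absInertia F)
    (h : τ * (σ : absoluteGaloisGroup F) * τ⁻¹ ∈ absInertia F) :
    (kummerCharacter F hn ha ι ⟨τ * σ * τ⁻¹, h⟩ : k) =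
      (kummerCharacter F hn ha ι σ : k) ^ (residueFieldCard F ^ m) := by
  have hmul : ∀ α β : absoluteGaloisGroup F, kummerCocycleInt F hn ha (α * β) =
      α • kummerCocycleInt F hn ha β * kummerCocycleInt F hn ha α :=
    kummerCocycleInt_mul hn ha
  -- `u = c(τ⁻¹)`; `τ • u * c τ = 1`
  have hτu : τ • kummerCocycleInt F hn ha τ⁻¹ * kummerCocycleInt F hn ha τ = 1 := by
    rw [← hmul, mul_inv_cancel, kummerCocycleInt_one]
  -- the identity `c(τστ⁻¹) * τ • u = (τσ) • u * τ • c σ`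
  have key : kummerCocycleInt F hn ha (τ * σ * τ⁻¹) * τ • kummerCocycleInt F hn ha τ⁻¹ =
      (τ * (σ : absoluteGaloisGroup F)) • kummerCocycleInt F hn ha τ⁻¹ *
        τ • kummerCocycleInt F hn ha σ := by
    rw [hmul, hmul τ σ]
    calc (τ * (σ : absoluteGaloisGroup F)) • kummerCocycleInt F hn ha τ⁻¹ *
          (τ • kummerCocycleInt F hn ha σ * kummerCocycleInt F hn ha τ) *
          τ • kummerCocycleInt F hn ha τ⁻¹
        = (τ * (σ : absoluteGaloisGroup F)) • kummerCocycleInt F hn ha τ⁻¹ *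
            τ • kummerCocycleInt F hn ha σ *
            (τ • kummerCocycleInt F hn ha τ⁻¹ * kummerCocycleInt F hn ha τ) := by ring
      _ = (τ * (σ : absoluteGaloisGroup F)) • kummerCocycleInt F hn ha τ⁻¹ *
            τ • kummerCocycleInt F hn ha σ := by rw [hτu, mul_one]
  -- congruences modulo `𝔓`
  have hτ' : ∀ x : absIntegers 𝒪[F] F,
      τ • x - x ^ residueFieldCard F ^ m ∈ absMaximalIdeal F := isFrobPow_natCast_iff.mp hτ
  have hσu : (σ : absoluteGaloisGroup F) • kummerCocycleInt F hn ha τ⁻¹ -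
      kummerCocycleInt F hn ha τ⁻¹ ∈ absMaximalIdeal F := σ.2 _
  have h1 : (τ * (σ : absoluteGaloisGroup F)) • kummerCocycleInt F hn ha τ⁻¹ -
      τ • kummerCocycleInt F hn ha τ⁻¹ ∈ absMaximalIdeal F := by
    have hq : residueFieldCard F ^ m ≠ 0 := pow_ne_zero _ (residueFieldCard_ne_zero F)
    have hpow : ((σ : absoluteGaloisGroup F) • kummerCocycleInt F hn ha τ⁻¹ -
        kummerCocycleInt F hn ha τ⁻¹) ^ residueFieldCard F ^ m ∈ absMaximalIdeal F :=
      (absMaximalIdeal F).pow_mem_of_mem hσu _ (Nat.pos_of_ne_zero hq)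
    have := (absMaximalIdeal F).add_mem
      (hτ' ((σ : absoluteGaloisGroup F) • kummerCocycleInt F hn ha τ⁻¹ - kummerCocycleInt F hn ha τ⁻¹))
      hpow
    rwa [sub_add_cancel, smul_sub, ← mul_smul] at this
  have h2 : τ • kummerCocycleInt F hn ha σ - kummerCocycleInt F hn ha σ ^ residueFieldCard F ^ m ∈
      absMaximalIdeal F := hτ' _
  -- pass to the quotient ring `S ⧸ 𝔓`
  have hunit : IsUnit (Ideal.Quotient.mk (absMaximalIdeal F) (τ • kummerCocycleInt F hn ha τ⁻¹)) := by
    refine IsUnit.of_pow_eq_one (n := n) ?_ hn.ne'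
    rw [← map_pow, ← smul_pow', kummerCocycleInt_pow, smul_one, map_one]
  have hq1 : Ideal.Quotient.mk (absMaximalIdeal F)
        ((τ * (σ : absoluteGaloisGroup F)) • kummerCocycleInt F hn ha τ⁻¹) =
      Ideal.Quotient.mk (absMaximalIdeal F) (τ • kummerCocycleInt F hn ha τ⁻¹) :=
    Ideal.Quotient.eq.mpr h1
  have hq2 : Ideal.Quotient.mk (absMaximalIdeal F) (τ • kummerCocycleInt F hn ha σ) =
      Ideal.Quotient.mk (absMaximalIdeal F) (kummerCocycleInt F hn ha σ) ^ residueFieldCard F ^ m := by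
    rw [← map_pow]; exact Ideal.Quotient.eq.mpr h2
  have hq : Ideal.Quotient.mk (absMaximalIdeal F) (kummerCocycleInt F hn ha (τ * σ * τ⁻¹)) =
      Ideal.Quotient.mk (absMaximalIdeal F) (kummerCocycleInt F hn ha σ) ^ residueFieldCard F ^ m := by
    have := congrArg (Ideal.Quotient.mk (absMaximalIdeal F)) key
    rw [map_mul, map_mul, hq1, hq2,
      mul_comm (Ideal.Quotient.mk (absMaximalIdeal F) (τ • kummerCocycleInt F hn ha τ⁻¹))] at this
    exact hunit.mul_left_injective this
  rw [coe_kummerCharacter_apply, coe_kummerCharacter_apply, ← map_pow]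
  exact congrArg ι hq

/-! ### Roots of unity in the coefficient field -/

/-- The residue characteristic `p = ringChar 𝓀[F]` is a prime. [folklore] -/
theorem ringChar_residueField_prime : (ringChar 𝓀[F]).Prime :=
  CharP.char_is_prime 𝓀[F] _

/-- A coefficient field `k` receiving a residue embedding `ι : S ⧸ 𝔓 →+* k` has characteristic
`p = char 𝓀[F]` (`p ∈ 𝔓`).  Ref: Serre, Duke Math. J. 54 (1987), §2.1. [folklore] -/
theorem charP_of_residueEmbedding (ι : absIntegers 𝒪[F] F ⧸ absMaximalIdeal F →+* k) :
    CharP k (ringChar 𝓀[F]) := by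
  have hp := (ringChar_residueField_prime (F := F))
  haveI : Fact (ringChar 𝓀[F]).Prime := ⟨hp⟩
  have h0 : ((ringChar 𝓀[F] : ℕ) : k) = 0 := by
    have h1 : ((ringChar 𝓀[F] : ℕ) : absIntegers 𝒪[F] F ⧸ absMaximalIdeal F) = 0 := by
      rw [← map_natCast (Ideal.Quotient.mk (absMaximalIdeal F)), Ideal.Quotient.eq_zero_iff_mem]
      exact IsFrobPow.natCast_ringChar_mem_absMaximalIdeal
    rw [← map_natCast ι, h1, map_zero]
  exact (CharP.charP_iff_prime_eq_zero hp).mpr h0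

/-- Reduction modulo a proper ideal `Q ⊇ 𝔓`... more precisely: if `η ∈ S` satisfies
`η ^ e = 1` with `p ∤ e` and `η - 1 ∈ Q` for an ideal `Q ≠ ⊤` of `S`, then `η = 1`.  (If
`η ≠ 1` it is a primitive `m`-th root of unity for some `1 < m ∣ e`; then
`0 = 1 + η + ⋯ + η^{m-1} ≡ m (mod Q)`, so the unit `m` lies in `Q`.)
Ref: Serre, Invent. Math. 15 (1972), §1.3 (`μ_d ≃ μ_d(k_s)` by reduction). [folklore] -/
theorem eq_one_of_pow_eq_one_of_sub_one_mem {Q : Ideal (absIntegers 𝒪[F] F)} (hQ : Q ≠ ⊤)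
    {e : ℕ} (he : 0 < e) (hpe : ¬ ringChar 𝓀[F] ∣ e) {η : absIntegers 𝒪[F] F} (hη : η ^ e = 1)
    (h1 : η - 1 ∈ Q) : η = 1 := by
  classical
  by_contra hne
  set m := orderOf η with hm
  have hprim : IsPrimitiveRoot η m := IsPrimitiveRoot.orderOf η
  have hmdvd : m ∣ e := orderOf_dvd_of_pow_eq_one hη
  have hm1 : 1 < m := by
    rcases Nat.lt_or_ge 1 m with h | h
    · exact h
    · exfalso
      have hmpos : 0 < m := orderOf_pos_iff.mpr (isOfFinOrder_iff_pow_eq_one.mpr ⟨e, he, hη⟩)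
      have hm1 : m = 1 := le_antisymm h hmpos
      exact hne (orderOf_eq_one_iff.mp hm1)
  -- `∑_{i<m} η^i = 0` and `∑_{i<m} η^i ≡ m (mod Q)`
  have hsum : (Finset.range m).sum (fun i => η ^ i) = 0 := hprim.geom_sum_eq_zero hm1
  have hcong : (Finset.range m).sum (fun i => η ^ i) - (m : absIntegers 𝒪[F] F) ∈ Q := by
    have : (Finset.range m).sum (fun i => η ^ i) - (m : absIntegers 𝒪[F] F) =
        (Finset.range m).sum (fun i => (η ^ i - 1)) := by
      rw [Finset.sum_sub_distrib, Finset.sum_const, Finset.card_range, nsmul_eq_mul, mul_one]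
    rw [this]
    refine Q.sum_mem fun i _ => ?_
    obtain ⟨r, hr⟩ := sub_one_dvd_pow_sub_one η i
    rw [hr]
    exact Q.mul_mem_right _ h1
  rw [hsum, zero_sub, Q.neg_mem_iff] at hcong
  -- but `m` is a unit of `S` (`p ∤ m`, so `m` is a unit of `𝒪[F]`)
  have hpm : ¬ ringChar 𝓀[F] ∣ m := fun h => hpe (h.trans hmdvd)
  have hunit : IsUnit ((m : ℕ) : absIntegers 𝒪[F] F) := by
    have hu : IsUnit ((m : ℕ) : 𝒪[F]) := by
      by_contra hnu
      have hmem : ((m : ℕ) : 𝒪[F]) ∈ 𝓂[F] := (IsLocalRing.mem_maximalIdeal _).mpr hnu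
      rw [← IsLocalRing.residue_eq_zero_iff, map_natCast] at hmem
      exact hpm ((ringChar.spec 𝓀[F] m).mp hmem)
    simpa using hu.map (algebraMap 𝒪[F] (absIntegers 𝒪[F] F))
  exact hQ (Ideal.eq_top_of_isUnit_mem Q hcong hunit)

/-- **Roots of unity of order prime to `p` in the coefficient field.**  If `k` receives a ring
homomorphism `ι : S ⧸ 𝔓 →+* k` (`S ⧸ 𝔓 ≃ 𝔽̄_q`), then for every `e > 0` with `p ∤ e` the field
`k` contains a primitive `e`-th root of unity, namely `ι` of the reduction of a primitive `e`-th
root of unity `ζ ∈ F̄` (which is integral, and whose reduction keeps order `e` by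
`eq_one_of_pow_eq_one_of_sub_one_mem` applied to the proper ideal `ker (ι ∘ mk) ⊇ 𝔓`).
Ref: Serre, Invent. Math. 15 (1972), §1.3 (`μ_d ≃ μ_d(k_s)`); Serre, Duke Math. J. 54
(1987), §2.1. [folklore] -/
theorem exists_isPrimitiveRoot_of_not_dvd (ι : absIntegers 𝒪[F] F ⧸ absMaximalIdeal F →+* k)
    {e : ℕ} (he : 0 < e) (hpe : ¬ ringChar 𝓀[F] ∣ e) : ∃ ζ : k, IsPrimitiveRoot ζ e := by
  classical
  -- `e ≠ 0` in `F`
  haveI : NeZero ((e : ℕ) : F) := by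
    refine ⟨fun h0 => hpe ?_⟩
    have hF : ringChar F ∣ e := (ringChar.spec F e).mp h0
    have hpF : ringChar 𝓀[F] ∣ ringChar F := by
      rw [← ringChar.spec 𝓀[F]]
      have h' : ((ringChar F : ℕ) : 𝒪[F]) = 0 :=
        Subtype.ext (by simp)
      rw [← map_natCast (IsLocalRing.residue 𝒪[F]), h', map_zero]
    exact hpF.trans hF
  obtain ⟨ζ, hζ⟩ := HasEnoughRootsOfUnity.exists_primitiveRoot (AlgebraicClosure F) e
  -- `ζ` is integral over `𝒪[F]`
  have hζint : IsIntegral 𝒪[F] ζ := IsIntegral.of_pow he (by rw [hζ.pow_eq_one]; exact isIntegral_one)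
  set ζS : absIntegers 𝒪[F] F := ⟨ζ, hζint⟩ with hζS
  have hζS' : IsPrimitiveRoot ζS e :=
    IsPrimitiveRoot.of_map_of_injective (f := (absIntegers 𝒪[F] F).val) (by exact hζ)
      Subtype.val_injective
  let φ : absIntegers 𝒪[F] F →+* k := ι.comp (Ideal.Quotient.mk (absMaximalIdeal F))
  refine ⟨φ ζS, IsPrimitiveRoot.mk_of_lt _ he ?_ fun l hl0 hle => ?_⟩
  · rw [← map_pow, hζS'.pow_eq_one, map_one]
  · intro hl
    -- `ζS ^ l ≡ 1` modulo the proper ideal `ker φ`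
    have hQ : RingHom.ker φ ≠ ⊤ := RingHom.ker_ne_top φ
    have hmem : ζS ^ l - 1 ∈ RingHom.ker φ := by
      rw [RingHom.mem_ker, map_sub, map_pow, hl, map_one, sub_self]
    have hpow : (ζS ^ l) ^ e = 1 := by rw [← pow_mul, mul_comm, pow_mul, hζS'.pow_eq_one, one_pow]
    have := eq_one_of_pow_eq_one_of_sub_one_mem hQ he hpe hpow hmem
    exact hζS'.pow_ne_one_of_pos_of_lt hl0.ne' hle this

end Characters

end Literature.NumberTheory.GaloisRepresentations
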